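import Summits.BirchSwinnertonDyer.BirchSwinnertonDyer.Theorems.EisensteinPrimesBSDpOnCellCStubC3InvariantTransfers
import Summits.BirchSwinnertonDyer.BirchSwinnertonDyer.Theorems.EisensteinPrimesBSDpOnCellCStubC3RoadHOther
import HarnessLib

/-!
# Crux 4 `BSDpOnCellC` (stmt-BirchSwinnertonDyer-19034), line b1 v10, stub `stub_c3`: the SPLIT-sign twins
# of p613908 `…StubC3InvariantTransfers` — road R-β alone gives `λ(X_ac^∅) ≤ λ(𝓛^BDP)`; the IMC atom
# c3s♭′ plus `μ = 0` on EITHER side gives D′ at `𝔭̄` (cell `bsd-eis`, seat `bsd-line-x2-p2` gen 2,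
# D-0154 KEY row 5; route `EisensteinPrimes`)

HONEST FRAMING (cell `bsd-eis`, run/shared/lean/pub/bsd-eis/): conditional re-statements on the binders
of the typed SPLIT halves of the IMC atom of line b1 (`X2.SplitKolyvaginDivOnTreeIntOther`,
`X2.SplitIMCEqOnTreeIntOther`, `X2.SplitMuLambdaOnTreeIntOther`); everything PROVED from tree theorems
(the algebra is p613908 §1 and p609918); nothing about any curve is asserted; nothing booked; X2 stays
CONSTRUCTION-SHAPED; no label or count moves; BSD and the anticyclotomic main conjecture are proved for
no curve. Helper attached to stmt-BirchSwinnertonDyer-19034 (`--supports`), closes no stub. The split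
sub-cells of row B11 (`CellCSplitGV` / `CellCSplitNotGV`) are the larger population, hence this twin.

* §2 `lambdaInvariant_le_of_splitDivIntOther` — road R-β (split) + PUB ×4 + `μ(X_ac^∅) = 0` ⟹
  `λ(X_ac^∅ strict at 𝔭̄) ≤` every first-unit index of the frame (Euler-system upper bound).
* §3 `frame_shape_of_splitImcEq_of_mu_eq_zero`, `invariants_of_splitImcEq_of_frame_shape`,
  `splitMuLambdaOnTreeIntOther_of_imcEq_of_mu_eq_zero`, `splitMuLambdaOnTreeIntOther_of_imcEq_of_frame_shape`
  — D′ at `𝔭̄` (split) ⟸ c3s♭′ + `μ = 0` on either side.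

References: [Washington1997] §7.1, §13.2; [KellerYin2024] §3, §5.1, Thm. 5.1.3 (arXiv:2402.12781v2, PRE —
locator only; no sign hypothesis in §5); cell: RULING L31, p489067, p609918, p613908.
-/

set_option autoImplicit false
set_option linter.dupNamespace false -- the summit namespace `…BirchSwinnertonDyer.BirchSwinnertonDyer.Theorems` (Sub = Summit, D-0017) trips it

noncomputable section

open scoped Classical MatrixGroups ModularForm

open CongruenceSubgroup WeierstrassCurve NumberField IsDedekindDomain Field PowerSeries
  Literature.NumberTheory.EllipticCurves Literature.NumberTheory.EllipticCurves.GreenbergSelmer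
  Literature.NumberTheory.EllipticCurves.GreenbergVatsal2000
  Literature.NumberTheory.EllipticCurves.ModularForms
  Literature.NumberTheory.EllipticCurves.Rank1Residual
  Literature.NumberTheory.EllipticCurves.Rank1Residual.Typed
  Literature.NumberTheory.GaloisRepresentations Literature.NumberTheory.GaloisCohomology
  Literature.NumberTheory.Automorphic
  Summit.BirchSwinnertonDyer.Rank1Residual.X11b.AcSelmer
  Summit.BirchSwinnertonDyer.Rank1Residual.X11b.Halves
  Summit.BirchSwinnertonDyer.Rank1Residual.X11b
  Summit.BirchSwinnertonDyer.Rank1Residual Summit.BirchSwinnertonDyer.Rank1Residual.X1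
  Summit.BirchSwinnertonDyer.Rank1Residual.X2
  Summit.BirchSwinnertonDyer.BirchSwinnertonDyer.Theorems.StubC3MuLambdaInvariants
  Summit.BirchSwinnertonDyer.BirchSwinnertonDyer.Theorems.StubC3OneInequality

namespace Summit.BirchSwinnertonDyer.BirchSwinnertonDyer.Theorems.StubC3InvariantTransfersSplit

open StubC3InvariantTransfers

variable {p : ℕ} [Fact p.Prime]

/-! ### §2 Road R-β alone (split sign): the Euler-system bound `λ(X_ac^∅) ≤ λ(𝓛^BDP)` -/

section Datum

variable {W : WeierstrassCurve ℚ} [W.IsElliptic] [W.IsGloballyMinimal]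

/-- **Road R-β ⟹ `λ(X_ac^∅ strict at 𝔭̄) ≤ λ(𝓛)`** (SPLIT X2c data). Given GZK, modularity,
Poitou–Tate ×2 (torsion of `X_ac^∅`, c3h g4 `isTorsion_xAc_other_of_cellC`) and `X2.SplitKolyvaginDivOnTreeIntOther W p`
(`𝓕♭ ∣ p^k·Q` at every datum): at every datum with `μ(X_ac^∅) = 0`, every index `m` at which the frame `Q`
has its first unit coefficient satisfies `λ(X_ac^∅) ≤ m`. The upper bound on the algebraic `λ` is thus
the Kolyvagin half's content on invariants; equality needs the opposite bound (p611576). CONDITIONAL;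
nothing booked. [claim: KellerYin2024, status: under-review]
[cite: KellerYin2024, §3 (the reducible Heegner-point Kolyvagin system) (arXiv:2402.12781v2) (shape only; nothing asserted)]
[cite: Washington1997, §13.2 and §7.1 Prop. 7.2] -/
theorem lambdaInvariant_le_of_splitDivIntOther
    (hGZK : rank_eq_analyticRank_of_analyticRank_le_one) (hnf : exists_isNewformOf)
    (hPT : ∀ (K : Type) [Field K] [NumberField K], poitouTate_selmerStructure_duality K)
    (hPT2 : ∀ (K : Type) [Field K] [NumberField K], poitouTate_sha_tateDual K)
    (hdiv : SplitKolyvaginDivOnTreeIntOther W p) :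
    ∀ (N : ℕ) [NeZero N] (K : Type) [Field K] [NumberField K] (Dt : ModularParametrizationData W N)
        (H : HeegnerDatum N (NumberField.discr K)) (ιK : K →+* ℂ) (P : (W.baseChange K).toAffine.Point),
        CellC W p → W.HasSplitMultiplicativeReductionAtPrime p → W.conductorNorm ℤ = N →
        IsImaginaryQuadratic K → NumberField.discr K < -4 → SatisfiesHeegnerHypothesis N K →
        (W.quadraticTwist (NumberField.discr K : ℚ)).entireLFunction 1 ≠ 0 →
        WeierstrassCurve.Affine.Point.map ιK.toRatAlgHom P = heegnerPointComplex Dt H →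
        ¬ (p : ℤ) ∣ Dt.c → ¬ IsOfFinAddOrder P →
        Odd (NumberField.discr K) →
        ∀ (κ : ZpExtension K p), κ.IsAnticyclotomic →
          ∀ (γ : Field.absoluteGaloisGroup K) [Fact (κ.IsTopGenerator γ)]
            (𝔭 : HeightOneSpectrum (𝓞 K)), ((p : ℕ) : 𝓞 K) ∈ 𝔭.asIdeal →
            𝔭.asIdeal.ramificationIdx (𝓞 ℚ) = 1 → 𝔭.asIdeal.inertiaDeg (𝓞 ℚ) = 1 →
            ∀ (𝔭bar : HeightOneSpectrum (𝓞 K)), ((p : ℕ) : 𝓞 K) ∈ 𝔭bar.asIdeal → 𝔭bar ≠ 𝔭 →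
              ((Ideal.span {(p : ℤ)}).primesOver (𝓞 K)).ncard = 2 →
            ∀ (f : CuspForm (CongruenceSubgroup.Gamma0 N) 2), IsNewformOf W f →
              ∀ (ι' : PadicAlgCl p ≃+* ℂ),
                (∀ (w : InfinitePlace K) (k : 𝓞 K),
                  k ∈ 𝔭.asIdeal ↔ ‖ι'.symm (w.embedding (k : K))‖ < 1) →
                ∀ (ΩK : ℂ) (Ωp : ℂ_[p]) (Q : PowerSeries 𝓞_ℂ_[p]), ΩK ≠ 0 → ‖Ωp‖ = 1 →
                  R1.IsBDPLFunctionInt p ι' 𝔭 κ γ f ΩK Ωp Q →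
                    muInvariant p (XAc (W.baseChange K) p κ 𝔭bar ∅ γ) = 0 →
                      ∀ m : ℕ, (‖((PowerSeries.coeff m Q : 𝓞_ℂ_[p]) : ℂ_[p])‖ = 1 ∧
                      ∀ i < m, ‖((PowerSeries.coeff i Q : 𝓞_ℂ_[p]) : ℂ_[p])‖ < 1) →
                        lambdaInvariant p (XAc (W.baseChange K) p κ 𝔭bar ∅ γ) ≤ m := by
  intro N _ K _ _ Dt H ιK P hc hs hN hK hd4 hHN hLt hP hcM hPinf hodd κ hκ γ _ 𝔭 h𝔭 he hf 𝔭bar h𝔭bar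
    hne hsplit f hfW ι' hι' ΩK Ωp Q hΩK hΩp hQ hμ m hQm
  obtain ⟨F, hF⟩ :=
    (charIdeal_isPrincipal_holds p (XAc (W.baseChange K) p κ 𝔭bar ∅ γ)).principal
  have hchar : XAc.charIdeal (W.baseChange K) p κ 𝔭bar ∅ γ = Ideal.span {F} := hF
  obtain ⟨k, hk⟩ := hdiv N K Dt H ιK P hc hs hN hK hd4 hHN hLt hP hcM hPinf hodd κ hκ γ 𝔭 h𝔭 he
    hf 𝔭bar h𝔭bar hne hsplit f hfW ι' hι' ΩK Ωp Q hΩK hΩp hQ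
  haveI := module_finite_XAc_baseChange (W := W) p κ 𝔭bar γ
  have htor := (isTorsion_xAc_other_of_cellC hGZK hnf hPT hPT2 hc hK
        (fun q hq hqp ↦ hHN q hq (hqp.trans (hN ▸
          Summit.BirchSwinnertonDyer.Rank1Residual.X11b.dvd_conductorNorm_of_mult (W := W) hc.2.2.2)))
        hLt P hPinf κ hκ γ 𝔭bar h𝔭bar)
  have hFn := firstUnitCoeff_map_toCpInt_of_charIdeal_eq_span _ htor hμ hchar
  rw [hchar, Ideal.map_span, Set.image_singleton] at hk
  exact le_of_C_pow_mul_mem hk hFn hQm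

/-! ### §3 The IMC atom c3s♭′ + `μ = 0` on either side ⟹ D′ (split sign) -/

/-- **c3s♭′ at a datum + `μ(X_ac^∅) = 0` ⟹ the frame has its first unit coefficient at `λ(X_ac^∅)`**
(so `μ(𝓛) = 0` and `λ(𝓛) = λ(X_ac^∅)`): on every binder of `X2.SplitIMCEqOnTreeIntOther W p`, from
the atom `R1.IMCEqIntAt W p κ 𝔭̄ γ Q`, torsion (PUB ×4) and `μ(X_ac^∅) = 0`, by §1. CONDITIONAL;
nothing booked. [claim: KellerYin2024, status: under-review]
[cite: KellerYin2024, Thm. 5.1.3 = Thm. D and §5.1 (the μ-Lemma) (arXiv:2402.12781v2) (shape only; nothing asserted)]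
[cite: Washington1997, §13.2 and §7.1 Prop. 7.2] -/
theorem frame_shape_of_splitImcEq_of_mu_eq_zero
    (hGZK : rank_eq_analyticRank_of_analyticRank_le_one) (hnf : exists_isNewformOf)
    (hPT : ∀ (K : Type) [Field K] [NumberField K], poitouTate_selmerStructure_duality K)
    (hPT2 : ∀ (K : Type) [Field K] [NumberField K], poitouTate_sha_tateDual K)
    (himc : SplitIMCEqOnTreeIntOther W p) :
    ∀ (N : ℕ) [NeZero N] (K : Type) [Field K] [NumberField K] (Dt : ModularParametrizationData W N)
        (H : HeegnerDatum N (NumberField.discr K)) (ιK : K →+* ℂ) (P : (W.baseChange K).toAffine.Point),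
        CellC W p → W.HasSplitMultiplicativeReductionAtPrime p → W.conductorNorm ℤ = N →
        IsImaginaryQuadratic K → NumberField.discr K < -4 → SatisfiesHeegnerHypothesis N K →
        (W.quadraticTwist (NumberField.discr K : ℚ)).entireLFunction 1 ≠ 0 →
        WeierstrassCurve.Affine.Point.map ιK.toRatAlgHom P = heegnerPointComplex Dt H →
        ¬ (p : ℤ) ∣ Dt.c → ¬ IsOfFinAddOrder P →
        Odd (NumberField.discr K) →
        ∀ (κ : ZpExtension K p), κ.IsAnticyclotomic →
          ∀ (γ : Field.absoluteGaloisGroup K) [Fact (κ.IsTopGenerator γ)]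
            (𝔭 : HeightOneSpectrum (𝓞 K)), ((p : ℕ) : 𝓞 K) ∈ 𝔭.asIdeal →
            𝔭.asIdeal.ramificationIdx (𝓞 ℚ) = 1 → 𝔭.asIdeal.inertiaDeg (𝓞 ℚ) = 1 →
            ∀ (𝔭bar : HeightOneSpectrum (𝓞 K)), ((p : ℕ) : 𝓞 K) ∈ 𝔭bar.asIdeal → 𝔭bar ≠ 𝔭 →
              ((Ideal.span {(p : ℤ)}).primesOver (𝓞 K)).ncard = 2 →
            ∀ (f : CuspForm (CongruenceSubgroup.Gamma0 N) 2), IsNewformOf W f →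
              ∀ (ι' : PadicAlgCl p ≃+* ℂ),
                (∀ (w : InfinitePlace K) (k : 𝓞 K),
                  k ∈ 𝔭.asIdeal ↔ ‖ι'.symm (w.embedding (k : K))‖ < 1) →
                ∀ (ΩK : ℂ) (Ωp : ℂ_[p]) (Q : PowerSeries 𝓞_ℂ_[p]), ΩK ≠ 0 → ‖Ωp‖ = 1 →
                  R1.IsBDPLFunctionInt p ι' 𝔭 κ γ f ΩK Ωp Q →
                    muInvariant p (XAc (W.baseChange K) p κ 𝔭bar ∅ γ) = 0 →
                      (‖((PowerSeries.coeff (lambdaInvariant p (XAc (W.baseChange K) p κ 𝔭bar ∅ γ)) Q : 𝓞_ℂ_[p]) : ℂ_[p])‖ = 1 ∧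
                      ∀ i < (lambdaInvariant p (XAc (W.baseChange K) p κ 𝔭bar ∅ γ)), ‖((PowerSeries.coeff i Q : 𝓞_ℂ_[p]) : ℂ_[p])‖ < 1) := by
  intro N _ K _ _ Dt H ιK P hc hs hN hK hd4 hHN hLt hP hcM hPinf hodd κ hκ γ _ 𝔭 h𝔭 he hf 𝔭bar h𝔭bar
    hne hsplit f hfW ι' hι' ΩK Ωp Q hΩK hΩp hQ hμ
  obtain ⟨F, hF⟩ :=
    (charIdeal_isPrincipal_holds p (XAc (W.baseChange K) p κ 𝔭bar ∅ γ)).principal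
  have hchar : XAc.charIdeal (W.baseChange K) p κ 𝔭bar ∅ γ = Ideal.span {F} := hF
  have heq := himc N K Dt H ιK P hc hs hN hK hd4 hHN hLt hP hcM hPinf hodd κ hκ γ 𝔭 h𝔭 he
    hf 𝔭bar h𝔭bar hne hsplit f hfW ι' hι' ΩK Ωp Q hΩK hΩp hQ
  unfold R1.IMCEqIntAt at heq
  rw [hchar, Ideal.map_span, Set.image_singleton] at heq
  haveI := module_finite_XAc_baseChange (W := W) p κ 𝔭bar γ
  have htor := (isTorsion_xAc_other_of_cellC hGZK hnf hPT hPT2 hc hK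
        (fun q hq hqp ↦ hHN q hq (hqp.trans (hN ▸
          Summit.BirchSwinnertonDyer.Rank1Residual.X11b.dvd_conductorNorm_of_mult (W := W) hc.2.2.2)))
        hLt P hPinf κ hκ γ 𝔭bar h𝔭bar)
  exact firstUnitCoeff_of_span_singleton_eq heq
    (firstUnitCoeff_map_toCpInt_of_charIdeal_eq_span _ htor hμ hchar)

/-- **c3s♭′ at a datum + a first unit coefficient of the frame at `m` ⟹ `μ(X_ac^∅) = 0 ∧ λ(X_ac^∅) = m`**
(analytic `μ = 0` transports to the algebraic side through the ideal equality): §1 in the other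
direction + the dictionary p609918. CONDITIONAL; nothing booked. [claim: KellerYin2024, status: under-review]
[cite: KellerYin2024, Thm. 5.1.3 = Thm. D (arXiv:2402.12781v2) (shape only; nothing asserted)]
[cite: Washington1997, §13.2 and §7.1 Prop. 7.2] -/
theorem invariants_of_splitImcEq_of_frame_shape
    (hGZK : rank_eq_analyticRank_of_analyticRank_le_one) (hnf : exists_isNewformOf)
    (hPT : ∀ (K : Type) [Field K] [NumberField K], poitouTate_selmerStructure_duality K)
    (hPT2 : ∀ (K : Type) [Field K] [NumberField K], poitouTate_sha_tateDual K)
    (himc : SplitIMCEqOnTreeIntOther W p) :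
    ∀ (N : ℕ) [NeZero N] (K : Type) [Field K] [NumberField K] (Dt : ModularParametrizationData W N)
        (H : HeegnerDatum N (NumberField.discr K)) (ιK : K →+* ℂ) (P : (W.baseChange K).toAffine.Point),
        CellC W p → W.HasSplitMultiplicativeReductionAtPrime p → W.conductorNorm ℤ = N →
        IsImaginaryQuadratic K → NumberField.discr K < -4 → SatisfiesHeegnerHypothesis N K →
        (W.quadraticTwist (NumberField.discr K : ℚ)).entireLFunction 1 ≠ 0 →
        WeierstrassCurve.Affine.Point.map ιK.toRatAlgHom P = heegnerPointComplex Dt H →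
        ¬ (p : ℤ) ∣ Dt.c → ¬ IsOfFinAddOrder P →
        Odd (NumberField.discr K) →
        ∀ (κ : ZpExtension K p), κ.IsAnticyclotomic →
          ∀ (γ : Field.absoluteGaloisGroup K) [Fact (κ.IsTopGenerator γ)]
            (𝔭 : HeightOneSpectrum (𝓞 K)), ((p : ℕ) : 𝓞 K) ∈ 𝔭.asIdeal →
            𝔭.asIdeal.ramificationIdx (𝓞 ℚ) = 1 → 𝔭.asIdeal.inertiaDeg (𝓞 ℚ) = 1 →
            ∀ (𝔭bar : HeightOneSpectrum (𝓞 K)), ((p : ℕ) : 𝓞 K) ∈ 𝔭bar.asIdeal → 𝔭bar ≠ 𝔭 →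
              ((Ideal.span {(p : ℤ)}).primesOver (𝓞 K)).ncard = 2 →
            ∀ (f : CuspForm (CongruenceSubgroup.Gamma0 N) 2), IsNewformOf W f →
              ∀ (ι' : PadicAlgCl p ≃+* ℂ),
                (∀ (w : InfinitePlace K) (k : 𝓞 K),
                  k ∈ 𝔭.asIdeal ↔ ‖ι'.symm (w.embedding (k : K))‖ < 1) →
                ∀ (ΩK : ℂ) (Ωp : ℂ_[p]) (Q : PowerSeries 𝓞_ℂ_[p]), ΩK ≠ 0 → ‖Ωp‖ = 1 →
                  R1.IsBDPLFunctionInt p ι' 𝔭 κ γ f ΩK Ωp Q →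
                    ∀ m : ℕ, (‖((PowerSeries.coeff m Q : 𝓞_ℂ_[p]) : ℂ_[p])‖ = 1 ∧
                      ∀ i < m, ‖((PowerSeries.coeff i Q : 𝓞_ℂ_[p]) : ℂ_[p])‖ < 1) →
                        muInvariant p (XAc (W.baseChange K) p κ 𝔭bar ∅ γ) = 0 ∧ lambdaInvariant p (XAc (W.baseChange K) p κ 𝔭bar ∅ γ) = m := by
  intro N _ K _ _ Dt H ιK P hc hs hN hK hd4 hHN hLt hP hcM hPinf hodd κ hκ γ _ 𝔭 h𝔭 he hf 𝔭bar h𝔭bar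
    hne hsplit f hfW ι' hι' ΩK Ωp Q hΩK hΩp hQ m hQm
  obtain ⟨F, hF⟩ :=
    (charIdeal_isPrincipal_holds p (XAc (W.baseChange K) p κ 𝔭bar ∅ γ)).principal
  have hchar : XAc.charIdeal (W.baseChange K) p κ 𝔭bar ∅ γ = Ideal.span {F} := hF
  have heq := himc N K Dt H ιK P hc hs hN hK hd4 hHN hLt hP hcM hPinf hodd κ hκ γ 𝔭 h𝔭 he
    hf 𝔭bar h𝔭bar hne hsplit f hfW ι' hι' ΩK Ωp Q hΩK hΩp hQ
  unfold R1.IMCEqIntAt at heq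
  rw [hchar, Ideal.map_span, Set.image_singleton] at heq
  haveI := module_finite_XAc_baseChange (W := W) p κ 𝔭bar γ
  have htor := (isTorsion_xAc_other_of_cellC hGZK hnf hPT hPT2 hc hK
        (fun q hq hqp ↦ hHN q hq (hqp.trans (hN ▸
          Summit.BirchSwinnertonDyer.Rank1Residual.X11b.dvd_conductorNorm_of_mult (W := W) hc.2.2.2)))
        hLt P hPinf κ hκ γ 𝔭bar h𝔭bar)
  exact invariants_of_firstUnitCoeff_map_toCpInt _ htor hchar
    (firstUnitCoeff_of_span_singleton_eq heq.symm hQm)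

/-- **D′ at `𝔭̄` (split) ⟸ c3s♭′ + algebraic `μ = 0`** (+ PUB ×4): `X2.SplitMuLambdaOnTreeIntOther W p`
from `X2.SplitIMCEqOnTreeIntOther W p` and `μ(X_ac^∅ strict at 𝔭̄) = 0` at every datum — e.g. from
Keller–Yin Thm. D (PRE, by name via p487050) + the `μ`-Lemma for `𝔛_f`. CONDITIONAL; nothing booked.
[claim: KellerYin2024, status: under-review]
[cite: KellerYin2024, Thm. 5.1.3 = Thm. D and §5.1 (the μ-Lemma) (arXiv:2402.12781v2) (shape only; nothing asserted)] -/
theorem splitMuLambdaOnTreeIntOther_of_imcEq_of_mu_eq_zero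
    (hGZK : rank_eq_analyticRank_of_analyticRank_le_one) (hnf : exists_isNewformOf)
    (hPT : ∀ (K : Type) [Field K] [NumberField K], poitouTate_selmerStructure_duality K)
    (hPT2 : ∀ (K : Type) [Field K] [NumberField K], poitouTate_sha_tateDual K)
    (himc : SplitIMCEqOnTreeIntOther W p)
    (hμ : ∀ (N : ℕ) [NeZero N] (K : Type) [Field K] [NumberField K] (Dt : ModularParametrizationData W N)
        (H : HeegnerDatum N (NumberField.discr K)) (ιK : K →+* ℂ) (P : (W.baseChange K).toAffine.Point),
        CellC W p → W.HasSplitMultiplicativeReductionAtPrime p → W.conductorNorm ℤ = N →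
        IsImaginaryQuadratic K → NumberField.discr K < -4 → SatisfiesHeegnerHypothesis N K →
        (W.quadraticTwist (NumberField.discr K : ℚ)).entireLFunction 1 ≠ 0 →
        WeierstrassCurve.Affine.Point.map ιK.toRatAlgHom P = heegnerPointComplex Dt H →
        ¬ (p : ℤ) ∣ Dt.c → ¬ IsOfFinAddOrder P →
        Odd (NumberField.discr K) →
        ∀ (κ : ZpExtension K p), κ.IsAnticyclotomic →
          ∀ (γ : Field.absoluteGaloisGroup K) [Fact (κ.IsTopGenerator γ)]
            (𝔭 : HeightOneSpectrum (𝓞 K)), ((p : ℕ) : 𝓞 K) ∈ 𝔭.asIdeal →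
            𝔭.asIdeal.ramificationIdx (𝓞 ℚ) = 1 → 𝔭.asIdeal.inertiaDeg (𝓞 ℚ) = 1 →
            ∀ (𝔭bar : HeightOneSpectrum (𝓞 K)), ((p : ℕ) : 𝓞 K) ∈ 𝔭bar.asIdeal → 𝔭bar ≠ 𝔭 →
              ((Ideal.span {(p : ℤ)}).primesOver (𝓞 K)).ncard = 2 →
            ∀ (f : CuspForm (CongruenceSubgroup.Gamma0 N) 2), IsNewformOf W f →
              ∀ (ι' : PadicAlgCl p ≃+* ℂ),
                (∀ (w : InfinitePlace K) (k : 𝓞 K),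
                  k ∈ 𝔭.asIdeal ↔ ‖ι'.symm (w.embedding (k : K))‖ < 1) →
                ∀ (ΩK : ℂ) (Ωp : ℂ_[p]) (Q : PowerSeries 𝓞_ℂ_[p]), ΩK ≠ 0 → ‖Ωp‖ = 1 →
                  R1.IsBDPLFunctionInt p ι' 𝔭 κ γ f ΩK Ωp Q →
                    muInvariant p (XAc (W.baseChange K) p κ 𝔭bar ∅ γ) = 0) :
    SplitMuLambdaOnTreeIntOther W p :=
  splitMuLambdaOnTreeIntOther_of_invariants fun N _ K _ _ Dt H ιK P hc hs hN hK hd4 hHN hLt hP hcM hPinf hodd κ hκ γ _ 𝔭 h𝔭 he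
      hf 𝔭bar h𝔭bar hne hsplit f hfW ι' hι' ΩK Ωp Q hΩK hΩp hQ ↦
    ⟨(isTorsion_xAc_other_of_cellC hGZK hnf hPT hPT2 hc hK
          (fun q hq hqp ↦ hHN q hq (hqp.trans (hN ▸
            Summit.BirchSwinnertonDyer.Rank1Residual.X11b.dvd_conductorNorm_of_mult (W := W) hc.2.2.2)))
          hLt P hPinf κ hκ γ 𝔭bar h𝔭bar),
      hμ N K Dt H ιK P hc hs hN hK hd4 hHN hLt hP hcM hPinf hodd κ hκ γ 𝔭 h𝔭 he
        hf 𝔭bar h𝔭bar hne hsplit f hfW ι' hι' ΩK Ωp Q hΩK hΩp hQ,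
      frame_shape_of_splitImcEq_of_mu_eq_zero hGZK hnf hPT hPT2 himc N K Dt H ιK P hc hs hN hK hd4 hHN hLt hP hcM hPinf hodd κ hκ γ 𝔭 h𝔭 he
        hf 𝔭bar h𝔭bar hne hsplit f hfW ι' hι' ΩK Ωp Q hΩK hΩp hQ
        (hμ N K Dt H ιK P hc hs hN hK hd4 hHN hLt hP hcM hPinf hodd κ hκ γ 𝔭 h𝔭 he
          hf 𝔭bar h𝔭bar hne hsplit f hfW ι' hι' ΩK Ωp Q hΩK hΩp hQ)⟩

/-- **D′ at `𝔭̄` (split) ⟸ c3s♭′ + analytic `μ = 0`** (+ PUB ×4): `X2.SplitMuLambdaOnTreeIntOther W p`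
from `X2.SplitIMCEqOnTreeIntOther W p` and, at every datum, SOME first unit coefficient of the frame `Q`
(`μ(𝓛^BDP_𝔭) = 0`, e.g. a Hsieh-type analytic `μ`-theorem — nothing taken here). CONDITIONAL; nothing
booked. [claim: KellerYin2024, status: under-review]
[cite: KellerYin2024, Thm. 5.1.3 = Thm. D (arXiv:2402.12781v2) (shape only; nothing asserted)]
[cite: Hsieh2014, Thm. B (the analytic μ-invariant; context only, nothing asserted)] -/
theorem splitMuLambdaOnTreeIntOther_of_imcEq_of_frame_shape
    (hGZK : rank_eq_analyticRank_of_analyticRank_le_one) (hnf : exists_isNewformOf)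
    (hPT : ∀ (K : Type) [Field K] [NumberField K], poitouTate_selmerStructure_duality K)
    (hPT2 : ∀ (K : Type) [Field K] [NumberField K], poitouTate_sha_tateDual K)
    (himc : SplitIMCEqOnTreeIntOther W p)
    (hframe : ∀ (N : ℕ) [NeZero N] (K : Type) [Field K] [NumberField K] (Dt : ModularParametrizationData W N)
        (H : HeegnerDatum N (NumberField.discr K)) (ιK : K →+* ℂ) (P : (W.baseChange K).toAffine.Point),
        CellC W p → W.HasSplitMultiplicativeReductionAtPrime p → W.conductorNorm ℤ = N →
        IsImaginaryQuadratic K → NumberField.discr K < -4 → SatisfiesHeegnerHypothesis N K →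
        (W.quadraticTwist (NumberField.discr K : ℚ)).entireLFunction 1 ≠ 0 →
        WeierstrassCurve.Affine.Point.map ιK.toRatAlgHom P = heegnerPointComplex Dt H →
        ¬ (p : ℤ) ∣ Dt.c → ¬ IsOfFinAddOrder P →
        Odd (NumberField.discr K) →
        ∀ (κ : ZpExtension K p), κ.IsAnticyclotomic →
          ∀ (γ : Field.absoluteGaloisGroup K) [Fact (κ.IsTopGenerator γ)]
            (𝔭 : HeightOneSpectrum (𝓞 K)), ((p : ℕ) : 𝓞 K) ∈ 𝔭.asIdeal →
            𝔭.asIdeal.ramificationIdx (𝓞 ℚ) = 1 → 𝔭.asIdeal.inertiaDeg (𝓞 ℚ) = 1 →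
            ∀ (𝔭bar : HeightOneSpectrum (𝓞 K)), ((p : ℕ) : 𝓞 K) ∈ 𝔭bar.asIdeal → 𝔭bar ≠ 𝔭 →
              ((Ideal.span {(p : ℤ)}).primesOver (𝓞 K)).ncard = 2 →
            ∀ (f : CuspForm (CongruenceSubgroup.Gamma0 N) 2), IsNewformOf W f →
              ∀ (ι' : PadicAlgCl p ≃+* ℂ),
                (∀ (w : InfinitePlace K) (k : 𝓞 K),
                  k ∈ 𝔭.asIdeal ↔ ‖ι'.symm (w.embedding (k : K))‖ < 1) →
                ∀ (ΩK : ℂ) (Ωp : ℂ_[p]) (Q : PowerSeries 𝓞_ℂ_[p]), ΩK ≠ 0 → ‖Ωp‖ = 1 →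
                  R1.IsBDPLFunctionInt p ι' 𝔭 κ γ f ΩK Ωp Q →
                    ∃ m : ℕ, (‖((PowerSeries.coeff m Q : 𝓞_ℂ_[p]) : ℂ_[p])‖ = 1 ∧
                      ∀ i < m, ‖((PowerSeries.coeff i Q : 𝓞_ℂ_[p]) : ℂ_[p])‖ < 1)) :
    SplitMuLambdaOnTreeIntOther W p :=
  splitMuLambdaOnTreeIntOther_of_invariants fun N _ K _ _ Dt H ιK P hc hs hN hK hd4 hHN hLt hP hcM hPinf hodd κ hκ γ _ 𝔭 h𝔭 he
      hf 𝔭bar h𝔭bar hne hsplit f hfW ι' hι' ΩK Ωp Q hΩK hΩp hQ ↦ by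
    obtain ⟨m, hQm⟩ := hframe N K Dt H ιK P hc hs hN hK hd4 hHN hLt hP hcM hPinf hodd κ hκ γ 𝔭 h𝔭 he
      hf 𝔭bar h𝔭bar hne hsplit f hfW ι' hι' ΩK Ωp Q hΩK hΩp hQ
    obtain ⟨hμ, hlam⟩ := invariants_of_splitImcEq_of_frame_shape hGZK hnf hPT hPT2 himc N K Dt H ιK P hc hs hN hK hd4 hHN hLt hP hcM hPinf hodd κ hκ γ 𝔭 h𝔭 he
      hf 𝔭bar h𝔭bar hne hsplit f hfW ι' hι' ΩK Ωp Q hΩK hΩp hQ m hQm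
    exact ⟨(isTorsion_xAc_other_of_cellC hGZK hnf hPT hPT2 hc hK
          (fun q hq hqp ↦ hHN q hq (hqp.trans (hN ▸
            Summit.BirchSwinnertonDyer.Rank1Residual.X11b.dvd_conductorNorm_of_mult (W := W) hc.2.2.2)))
          hLt P hPinf κ hκ γ 𝔭bar h𝔭bar), hμ, hlam ▸ hQm⟩

end Datum

end Summit.BirchSwinnertonDyer.BirchSwinnertonDyer.Theorems.StubC3InvariantTransfersSplit

end
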